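import Mathlib.Analysis.SpecialFunctions.Pow.Real

/-!
# K1loc, line `Spectral` / thin start — helper: the abstract bookkeeping of the fibre ledger (B-5, real sequences)

Helper file of the prover lane on the crux `K1LocalisedCascade` (stmt-AnomalousDissipation-19491), route
`SawtoothPulseCascade` (S-D fibre ledger; memo v10 §11).  The per-phase window inequalities (`…HalfStepVT/HT`) are of the
shape `√(class at phase j+1) ≤ √(feeding class at phase j) + (junk amplitude w_j)`; this file collects the elementary
real-sequence lemmas that turn such chains into bounds UNIFORM in the number of phases:
* §1 amplitude accumulation `√x_n ≤ √x_{j₀} + Σ_{j₀≤j<n} w_j` and its energy form;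
* §2 threshold escalation: if `√a_{j+1}(X) ≤ √a_j(κX) + w_j` for all thresholds `X`, then
  `√a_{j+m}(X) ≤ √a_j(κ^m X) + Σ_{i<m} w_{j+i}` — after `m` back-steps the feeding threshold `κ^m X` is in the far tail;
* §3 the final indicator comparison: for `L ≤ K`, `[|k₀| < L] + [L ≤ |k₀| ∧ 13/10·|k₀| < γ|k₁|] ≤ [|k₀| < K] + [K ≤ |k₀| ∧ 13/10·|k₀| < γ|k₁|]`,
  so that the low band and the high off-cone channel of the target are dominated by the strip and the off-cone class of the
  ledger at any threshold `K` above `(1+1/250)c(γ²−3)ⁿ`.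
Pure real analysis; no definitions; no statement about the crux. [cite: Grafakos2014, Prop. 3.2.7 (3)] [problem: turb]
-/

-- `Summit.<Summit>.<Problem>`: single-conjunct summit, the duplicate namespace segment is deliberate.
set_option linter.dupNamespace false

noncomputable section

namespace Summit.AnomalousDissipation.AnomalousDissipation.Theorems.SawtoothPulseCascade.K1Window

open Finset

/-! ## §1 Amplitude accumulation -/

/-- **Amplitude chain**: `√x_{j+1} ≤ √x_j + w_j` for `j ≥ j₀` gives `√x_{j₀+m} ≤ √x_{j₀} + Σ_{i<m} w_{j₀+i}`. [folklore] -/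
theorem sqrt_le_sqrt_add_sum_of_step {x w : ℕ → ℝ} {j₀ : ℕ}
    (h : ∀ j, j₀ ≤ j → Real.sqrt (x (j + 1)) ≤ Real.sqrt (x j) + w j) (m : ℕ) :
    Real.sqrt (x (j₀ + m)) ≤ Real.sqrt (x j₀) + ∑ i ∈ range m, w (j₀ + i) := by
  induction m with
  | zero => simp
  | succ m ih =>
    rw [sum_range_succ, ← add_assoc (j₀) m 1]
    exact (h (j₀ + m) (Nat.le_add_right _ _)).trans (by linarith)

/-- **Energy chain**: `x_{j+1} ≤ x_j + e_j` for `j ≥ j₀` gives `x_{j₀+m} ≤ x_{j₀} + Σ_{i<m} e_{j₀+i}`. [folklore] -/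
theorem le_add_sum_of_step {x e : ℕ → ℝ} {j₀ : ℕ} (h : ∀ j, j₀ ≤ j → x (j + 1) ≤ x j + e j) (m : ℕ) :
    x (j₀ + m) ≤ x j₀ + ∑ i ∈ range m, e (j₀ + i) := by
  induction m with
  | zero => simp
  | succ m ih =>
    rw [sum_range_succ, ← add_assoc (j₀) m 1]
    exact (h (j₀ + m) (Nat.le_add_right _ _)).trans (by linarith)

/-- From an amplitude bound to an energy bound: `√x ≤ s`, `0 ≤ x` ⇒ `x ≤ s²`. [folklore] -/
theorem le_sq_of_sqrt_le {x s : ℝ} (hx : 0 ≤ x) (h : Real.sqrt x ≤ s) : x ≤ s ^ 2 := by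
  have h0 : 0 ≤ Real.sqrt x := Real.sqrt_nonneg _
  calc x = Real.sqrt x ^ 2 := (Real.sq_sqrt hx).symm
    _ ≤ s ^ 2 := pow_le_pow_left₀ h0 h 2

/-- The two-term window shape: `x ≤ (u + v)²` with `u ≤ u'`, `v ≤ v'`, `0 ≤ u`, `0 ≤ v` ⇒ `x ≤ (u' + v')²`. [folklore] -/
theorem le_add_sq_mono {x u v u' v' : ℝ} (h : x ≤ (u + v) ^ 2) (hu : 0 ≤ u) (hv : 0 ≤ v) (hu' : u ≤ u') (hv' : v ≤ v') :
    x ≤ (u' + v') ^ 2 :=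
  h.trans (pow_le_pow_left₀ (add_nonneg hu hv) (add_le_add hu' hv') 2)

/-- Amplitude form of the window shape: `x ≤ (u + √y)²`, `0 ≤ u` ⇒ `√x ≤ u + √y`. [folklore] -/
theorem sqrt_le_add_sqrt_of_le_sq {x u y : ℝ} (h : x ≤ (u + Real.sqrt y) ^ 2) (hu : 0 ≤ u) :
    Real.sqrt x ≤ u + Real.sqrt y := by
  have h0 : 0 ≤ u + Real.sqrt y := add_nonneg hu (Real.sqrt_nonneg _)
  calc Real.sqrt x ≤ Real.sqrt ((u + Real.sqrt y) ^ 2) := Real.sqrt_le_sqrt h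
    _ = u + Real.sqrt y := Real.sqrt_sq h0

/-- Disjoint pieces: `x = x₁ + x₂`, `x₁ ≤ y₁`, `x₂ ≤ (u + √y₂)²`, `0 ≤ u`, `0 ≤ y₁` ⇒ `√x ≤ u + √(y₁ + y₂)`
(low fibres pass through exactly, chopped fibres pay the junk `u`). [folklore] -/
theorem sqrt_add_le_of_pieces {x₁ x₂ y₁ y₂ u : ℝ} (hx₁ : 0 ≤ x₁) (h₁ : x₁ ≤ y₁) (h₂ : x₂ ≤ (u + Real.sqrt y₂) ^ 2)
    (hu : 0 ≤ u) (hy₂ : 0 ≤ y₂) :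
    Real.sqrt (x₁ + x₂) ≤ u + Real.sqrt (y₁ + y₂) := by
  have hy₁ : 0 ≤ y₁ := hx₁.trans h₁
  have hs₂ := sqrt_le_add_sqrt_of_le_sq h₂ hu
  -- `√(x₁+x₂) ≤ √(y₁ + (u+√y₂)²) ≤ u + √(y₁+y₂)` (Minkowski in `ℝ²` for the vectors `(0,u)` and `(√y₁, √y₂)`)
  have hA : Real.sqrt (x₁ + x₂) ≤ Real.sqrt (y₁ + (u + Real.sqrt y₂) ^ 2) := Real.sqrt_le_sqrt (add_le_add h₁ h₂)
  refine hA.trans ?_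
  rw [Real.sqrt_le_left (add_nonneg hu (Real.sqrt_nonneg _))]
  have e1 : Real.sqrt (y₁ + y₂) ^ 2 = y₁ + y₂ := Real.sq_sqrt (add_nonneg hy₁ hy₂)
  have e2 : Real.sqrt y₂ ^ 2 = y₂ := Real.sq_sqrt hy₂
  have hm : Real.sqrt y₂ ≤ Real.sqrt (y₁ + y₂) := Real.sqrt_le_sqrt (by linarith)
  nlinarith [Real.sqrt_nonneg y₂, Real.sqrt_nonneg (y₁ + y₂)]

/-! ## §2 Threshold escalation -/

/-- **Threshold escalation**: if the class above threshold `X` at phase `j+1` is fed by the class above `κX` at phase `j`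
plus a junk amplitude `w_j`, then after `m` phases `√a_{j+m}(X) ≤ √a_j(κ^m X) + Σ_{i<m} w_{j+i}`. [folklore] -/
theorem sqrt_le_escalate {a : ℕ → ℝ → ℝ} {w : ℕ → ℝ} {κ : ℝ} {j₀ : ℕ}
    (h : ∀ j, j₀ ≤ j → ∀ X : ℝ, Real.sqrt (a (j + 1) X) ≤ Real.sqrt (a j (κ * X)) + w j) :
    ∀ (m j : ℕ), j₀ ≤ j → ∀ X : ℝ, Real.sqrt (a (j + m) X) ≤ Real.sqrt (a j (κ ^ m * X)) + ∑ i ∈ range m, w (j + i) := by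
  intro m
  induction m with
  | zero => intro j _ X; simp
  | succ m ih =>
    intro j hj X
    have h1 := h (j + m) (hj.trans (Nat.le_add_right _ _)) X
    have h2 := ih j hj (κ * X)
    rw [sum_range_succ, ← add_assoc, ← add_assoc]
    calc Real.sqrt (a (j + m + 1) X) ≤ Real.sqrt (a (j + m) (κ * X)) + w (j + m) := h1
      _ ≤ Real.sqrt (a j (κ ^ m * (κ * X))) + ∑ i ∈ range m, w (j + i) + w (j + m) := by linarith
      _ = Real.sqrt (a j (κ ^ (m + 1) * X)) + ∑ i ∈ range m, w (j + i) + w (j + m) := by rw [pow_succ, mul_assoc]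

/-- **Escalation into a cap**: with a cap `a_j(Y) ≤ F_j(Y)` (the far tail) the escalated bound reads
`√a_{j+m}(X) ≤ √F_j(κ^m X) + Σ_{i<m} w_{j+i}`. [folklore] -/
theorem sqrt_le_escalate_cap {a F : ℕ → ℝ → ℝ} {w : ℕ → ℝ} {κ : ℝ} {j₀ : ℕ}
    (h : ∀ j, j₀ ≤ j → ∀ X : ℝ, Real.sqrt (a (j + 1) X) ≤ Real.sqrt (a j (κ * X)) + w j)
    (hF : ∀ j, j₀ ≤ j → ∀ Y : ℝ, a j Y ≤ F j Y) (m j : ℕ) (hj : j₀ ≤ j) (X : ℝ) :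
    Real.sqrt (a (j + m) X) ≤ Real.sqrt (F j (κ ^ m * X)) + ∑ i ∈ range m, w (j + i) :=
  (sqrt_le_escalate h m j hj X).trans (by linarith [Real.sqrt_le_sqrt (hF j hj (κ ^ m * X))])

/-- Only the LAST `m` junk amplitudes count: if `w` is dominated by a geometric sequence `w_i ≤ C θ^i` (`0 ≤ θ < 1`), then
`Σ_{i<m} w_{j+i} ≤ C θ^j/(1−θ)`. [folklore] -/
theorem sum_range_le_geometric {w : ℕ → ℝ} {C θ : ℝ} (hC : 0 ≤ C) (hθ0 : 0 ≤ θ) (hθ1 : θ < 1)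
    (hw : ∀ i, w i ≤ C * θ ^ i) (j m : ℕ) :
    ∑ i ∈ range m, w (j + i) ≤ C * θ ^ j / (1 - θ) := by
  have h1 : ∑ i ∈ range m, w (j + i) ≤ ∑ i ∈ range m, C * θ ^ j * θ ^ i :=
    sum_le_sum fun i _ => (hw (j + i)).trans (by rw [pow_add, mul_assoc])
  refine h1.trans ?_
  rw [← mul_sum]
  have hg : ∑ i ∈ range m, θ ^ i ≤ (1 - θ)⁻¹ := by
    rw [geom_sum_eq hθ1.ne m]
    have h1θ : 0 < 1 - θ := by linarith
    rw [div_le_iff_of_neg (by linarith : θ - 1 < 0)]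
    have : θ ^ m ≤ 1 := pow_le_one₀ hθ0 hθ1.le
    have hθm : 0 ≤ θ ^ m := pow_nonneg hθ0 m
    rw [show (1 - θ)⁻¹ * (θ - 1) = -1 by field_simp; ring]
    linarith
  calc C * θ ^ j * ∑ i ∈ range m, θ ^ i ≤ C * θ ^ j * (1 - θ)⁻¹ :=
        mul_le_mul_of_nonneg_left hg (by positivity)
    _ = C * θ ^ j / (1 - θ) := by rw [div_eq_mul_inv]

/-! ## §3 The final indicator comparison -/

/-- For `L ≤ K`: `[|x| < L] + [L ≤ |x| ∧ q] ≤ [|x| < K] + [K ≤ |x| ∧ q]` (indicators as reals). [folklore] -/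
theorem lowBand_offCone_indicator_mono {L K x : ℝ} (hLK : L ≤ K) (q : Prop) [Decidable q] :
    ((if |x| < L then (1 : ℝ) else 0) + if L ≤ |x| ∧ q then (1 : ℝ) else 0) ≤
      (if |x| < K then (1 : ℝ) else 0) + if K ≤ |x| ∧ q then (1 : ℝ) else 0 := by
  by_cases h1 : |x| < L
  · rw [if_pos h1, if_neg (fun h => (not_le.mpr h1) h.1), if_pos (h1.trans_le hLK),
      if_neg (fun h => (not_le.mpr (h1.trans_le hLK)) h.1)]
  · rw [if_neg h1]
    push Not at h1
    by_cases h2 : |x| < K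
    · rw [if_pos h2, if_neg (fun h : K ≤ |x| ∧ q => (not_le.mpr h2) h.1)]
      split_ifs <;> norm_num
    · rw [if_neg h2]
      push Not at h2
      by_cases hq : q
      · rw [if_pos ⟨h1, hq⟩, if_pos ⟨h2, hq⟩]
      · rw [if_neg (fun h => hq h.2), if_neg (fun h => hq h.2)]

/-- **Low band + high off-cone ≤ strip + off-cone class at any larger threshold**: for a nonnegative summable spectral
density `c` and `L ≤ K`,
`Σ' k, [|k₀| < L]c_k + Σ' k, [L ≤ |k₀| ∧ q_k]c_k ≤ Σ' k, [|k₀| < K]c_k + Σ' k, [K ≤ |k₀| ∧ q_k]c_k`. [folklore] -/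
theorem tsum_lowBand_offCone_le {ι : Type*} {c : ι → ℝ} (hc : Summable c) (hc0 : ∀ k, 0 ≤ c k) (x : ι → ℝ)
    (q : ι → Prop) [DecidablePred q] {L K : ℝ} (hLK : L ≤ K) :
    ∑' k, (if |x k| < L then (1 : ℝ) else 0) * c k + ∑' k, (if L ≤ |x k| ∧ q k then (1 : ℝ) else 0) * c k ≤
      ∑' k, (if |x k| < K then (1 : ℝ) else 0) * c k + ∑' k, (if K ≤ |x k| ∧ q k then (1 : ℝ) else 0) * c k := by
  have hI : ∀ (p : ι → Prop) [DecidablePred p], Summable fun k => (if p k then (1 : ℝ) else 0) * c k := by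
    intro p _
    refine Summable.of_nonneg_of_le (fun k => mul_nonneg (by split_ifs <;> norm_num) (hc0 k)) (fun k => ?_) hc
    exact mul_le_of_le_one_left (hc0 k) (by split_ifs <;> norm_num)
  rw [← (hI _).tsum_add (hI _), ← (hI _).tsum_add (hI _)]
  refine ((hI _).add (hI _)).tsum_le_tsum (fun k => ?_) ((hI _).add (hI _))
  rw [← add_mul, ← add_mul]
  exact mul_le_mul_of_nonneg_right (lowBand_offCone_indicator_mono hLK (q k)) (hc0 k)

end Summit.AnomalousDissipation.AnomalousDissipation.Theorems.SawtoothPulseCascade.K1Window
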